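import Mathlib
import HarnessLib

/-!
# The basic algorithm of pseudo-Boolean optimisation (Hammer–Rosenberg–Rudeanu; Boros–Hammer §4.6)

Topic `Literature/Combinatorics/Optimization`, companion of `PseudoBooleanMultilinear.lean`
(Boros–Hammer Prop. 2), `RosenbergQuadratization.lean`, `IsingMaxCut.lean`,
`KnapsackDynamicProgramming.lean`.  Source: E. Boros, P. L. Hammer, *Pseudo-Boolean optimization*,
Discrete Appl. Math. **123** (2002) 155–225 [BorosHammer2002] (held text
`paper:doi-10-1016-s0166-218x-01-00341-9`, chunks p0003, p0006, p0008, p0013–p0015 read by the seat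
2026-08-23):

* §2 eq. (1): “`f(x_1,…,x_n) = Σ_{S⊆V} c_S Π_{j∈S} x_j`”; eq. (3): “its `i`th derivative
  `Δ_i(x) = f(x_1,…,x_{i−1},1,x_{i+1},…,x_n) − f(x_1,…,x_{i−1},0,x_{i+1},…,x_n)`”, and “the functions
  `Δ_i` and `Θ_i` are themselves pseudo-Boolean functions, which depend on all the variables, but `x_i`.”
* §4.1 Proposition 3: the derivatives in terms of the coefficients, `Δ_i(x) = Σ_{S∋i} c_S Π_{j∈S∖{i}} x_j`
  (“Immediate from (1) by elementary calculations”).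
* §4.3 (conditions (17)): “a binary vector `x ∈ Bⁿ` is called a local minimum of `f` if `f(y) ≥ f(x)`
  for all neighboring vectors … every (global) minimum of `f` is also a local minimum”, and in a local
  minimum `x_i = 1` if `Δ_i(x) < 0`, `x_i = 0` if `Δ_i(x) > 0`.
* §4.6 **Basic algorithm**: “following [91], we present a general algorithm for finding the optimum of a
  pseudo-Boolean function … the so called basic algorithm, was introduced first in [87,88], and later
  simplified in [91] … conditions (17) can be viewed as a characterization of the components of a local
  minimum in terms of the other components … Such an expression could then be used to eliminate a
  variable, and substitute the minimization problem with another one having one variable less. … we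
  shall assume that variables are eliminated in the order `x_n, x_{n−1}, …, x_1`.
  BASICALGORITHM(`f`) … *Local optimality:* … choose `x_n` to be eliminated. Determine the pseudo-Boolean
  function `g_n` defined by `g_n(x_1,…,x_{n−1}) = 1` if `Δ_n(x_1,…,x_{n−1}) < 0`, and `0` otherwise.
  *Recursion:* Determine `f_{n−1}(x_1,…,x_{n−1}) := f(x_1,…,x_{n−1}, g_n(x_1,…,x_{n−1}))`, and obtain the
  optimal values for `x*_1,…,x*_{n−1}` by calling BASICALGORITHM(`f_{n−1}`). *Output:* Set
  `x*_n = g_n(x*_1,…,x*_{n−1})`, and RETURN the binary vector `x* = (x*_1,…,x*_n)`.” … “`x* = (1,0,1)` is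
  returned as a minimizer of `f`” (Example 4.8); “Instead of giving a detailed proof here, for which the
  reader is referred to [91] …”.
* §4.6 co-occurrence graph and **Theorem 2** (Crama et al. [47]): “`(i,j) ∈ E` iff `f` has a term for
  which `S ⊇ {i,j}` and `c_S ≠ 0`”; “If for a pseudo-Boolean function `f` its co-occurrence graph `G_f` is
  a partial `k`-tree, then BASICALGORITHM can be implemented to run in polynomial time in the input size
  `size(f)` and in `2^k`.”  Proof sketch: “`Δ_n` and thus `g_n` depend only on at most `k` of the
  variables … if the substitution of `g_n` into `f = f_n` … generates new terms … for a new edge `(i,j)` …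
  we must have `{i,j} ⊆ P_n` … the input to the next level is also a partial `k`-tree.”
  References of the source: [87,88] Hammer–Rosenberg–Rudeanu (1963), [91] P. L. Hammer, S. Rudeanu,
  *Boolean Methods in Operations Research and Related Areas* (Springer, 1968) [HammerRudeanu1968],
  [47] Y. Crama, P. Hansen, B. Jaumard, Discrete Appl. Math. **29** (1990) 171–185 [CramaHansenJaumard1990].

(pub-qadeq lane context — the HUBO / QUBO / Ising optimisation rows whose adjudication rests on an
EXACT classical optimum computed by variable elimination (‘exact DP over the interaction hypergraph’,
‘transfer-matrix recursion along the chain’): the Kipu BF-DCQO cluster A-627…A-630 (certificates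
C-A629 — 156-variable chains with `x_i x_{i+1}` and `x_i x_{i+1} x_{i+2}` terms, a 4-state recursion —
and the planned C-A627 / C-A628 on the heavy-hex nearest-neighbour HUBO class), E-42 / S-13, E-77
(LEAN-KNAPDP).  This file is the published statement that such an elimination returns a GLOBAL optimum,
for every pseudo-Boolean function and every elimination order, together with the locality fact that
drives its cost.  HONEST FRAMING: instance-level adjudication of specific advantage claims; no claim
about BQP vs BPP or the summit; nothing here concerns any device, solver implementation or running time
beyond the printed statements.)

## What is formalised (all proved, 0 named facts)

Points of `Bⁿ` are `Cube n = Fin n → Bool`; values in any linearly ordered additive commutative group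
`R` (ℤ, ℚ, ℝ); the eliminated variable is the LAST coordinate (`Fin.snoc` / `Fin.init`), as printed.

* `deltaLast f y = Δ_n(y)` (eq. (3) for `i = n`), `gLast f y = g_n(y)`, `elimLast f = f_{n−1}`;
  `elimLast_eq_min` (`f_{n−1}(y) = min(f(y,0), f(y,1))`), `elimLast_le`, `elimLast_init_le`.
* **`basicAlgorithm n f = x*`** — BASICALGORITHM by structural recursion; `basicAlgorithm_succ`,
  `apply_basicAlgorithm_succ` (`f(x*) = f_{n−1}(x*_1,…,x*_{n−1})`).
* **`apply_basicAlgorithm_le`** — correctness: `f(x*) ≤ f(x)` for every `x ∈ Bⁿ` (the returned vector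
  is a global minimiser); `isMinOn_basicAlgorithm`; **`apply_basicAlgorithm_eq_inf`** (`f(x*) = min_{Bⁿ} f`);
  `inf_elimLast_eq` (`min f_{n−1} = min f`); `le_apply_basicAlgorithm_neg` (maximisation via `−f`).
* Locality (the mechanism of Theorem 2): `DependsOn`; `deltaLast_add_of_indep`, `gLast_add_of_indep`,
  **`elimLast_add_of_indep`** (`(u+v)_{n−1} = u_{n−1} + v(·,0)` when `v` does not involve `x_n`),
  **`dependsOn_elimLast`** (`u` depends only on `P` ⇒ `u_{n−1}` depends only on `P ∖ {n}`).
* The multilinear polynomial on `Bⁿ`: `multilinearEval c` (eq. (1)), `lastNeighbours c` (co-occurrence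
  neighbours of `x_n`), **`deltaLast_multilinearEval`** (Proposition 3 for `i = n`),
  **`dependsOn_deltaLast_multilinearEval`** and `gLast_eq_of_agree_on_lastNeighbours` (`Δ_n`, `g_n`
  depend only on the co-occurrence neighbours of `x_n` — at most `2^{|N(n)|}` table entries).
* NOT formalised: the running-time statement of Theorem 2 as a cost model, partial `k`-trees /
  treewidth, the uniqueness of the multilinear form (that is `PseudoBooleanMultilinear.lean`, whose
  points are supports `T ⊆ V` rather than `Fin n → Bool`; the two encodings are not bridged here).
-/

namespace Literature.Combinatorics.Optimization.PseudoBooleanBasicAlgorithm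

open Fin Finset

/-- Points of `Bⁿ = {0,1}ⁿ`, coordinates indexed by `Fin n`. [cite: BorosHammer2002, §2 (“pseudo-Boolean functions f : Bⁿ → ℝ”)] -/
abbrev Cube (n : ℕ) := Fin n → Bool

variable {R : Type*} [AddCommGroup R] [LinearOrder R] [IsOrderedAddMonoid R]
variable {n : ℕ}

/-! ### The last derivative, the local-optimality choice `g_n`, and one elimination step -/

/-- The `n`-th derivative at the point `(y, ·)`: `Δ_n(y) = f(y, 1) − f(y, 0)`.
[cite: BorosHammer2002, §2 eq. (3) (“Δ_i(x) = f(x_1,…,x_{i−1},1,x_{i+1},…,x_n) − f(x_1,…,x_{i−1},0,x_{i+1},…,x_n)”)] -/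
def deltaLast (f : Cube (n + 1) → R) (y : Cube n) : R := f (snoc y true) - f (snoc y false)

/-- The choice function of the ‘Local optimality’ step: “`g_n(x_1,…,x_{n−1}) = 1` if
`Δ_n(x_1,…,x_{n−1}) < 0`, and `0` otherwise.” [cite: BorosHammer2002, §4.6 BASICALGORITHM (Local optimality)] -/
def gLast (f : Cube (n + 1) → R) (y : Cube n) : Bool := decide (deltaLast f y < 0)

/-- The ‘Recursion’ step: “`f_{n−1}(x_1,…,x_{n−1}) := f(x_1,…,x_{n−1}, g_n(x_1,…,x_{n−1}))`.”
[cite: BorosHammer2002, §4.6 BASICALGORITHM (Recursion)] -/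
def elimLast (f : Cube (n + 1) → R) : Cube n → R := fun y => f (snoc y (gLast f y))

/-- `f_{n−1}(y) = min(f(y,0), f(y,1))`: the eliminated function is the pointwise minimum over the
last coordinate. [cite: BorosHammer2002, §4.6 (“Such an expression could then be used to eliminate a variable, and substitute the minimization problem with another one having one variable less”)] -/
theorem elimLast_eq_min (f : Cube (n + 1) → R) (y : Cube n) :
    elimLast f y = min (f (snoc y false)) (f (snoc y true)) := by
  unfold elimLast gLast deltaLast
  by_cases h : f (snoc y true) - f (snoc y false) < 0
  · rw [decide_eq_true h, min_eq_right (le_of_lt (sub_neg.1 h))]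
  · rw [decide_eq_false h, min_eq_left (sub_nonneg.1 (le_of_not_gt h))]

/-- `f_{n−1}(y) ≤ f(y, b)` for both values `b` of the eliminated variable.
[cite: BorosHammer2002, §4.3 Proposition (conditions (17): in a local minimum x_i = 1 if Δ_i(x) < 0 and x_i = 0 if Δ_i(x) > 0)] -/
theorem elimLast_le (f : Cube (n + 1) → R) (y : Cube n) (b : Bool) : elimLast f y ≤ f (snoc y b) := by
  rw [elimLast_eq_min]
  cases b
  · exact min_le_left _ _
  · exact min_le_right _ _

/-- Hence `min f_{n−1} = min f`: every value of `f` is bounded below by a value of `f_{n−1}` at the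
truncated point, and every value of `f_{n−1}` IS a value of `f`.
[cite: BorosHammer2002, §4.6 (“substitute the minimization problem with another one having one variable less”)] -/
theorem elimLast_init_le (f : Cube (n + 1) → R) (x : Cube (n + 1)) : elimLast f (init x) ≤ f x := by
  have h := elimLast_le f (init x) (x (last n))
  rwa [snoc_init_self] at h

/-! ### BASICALGORITHM and its correctness -/

/-- **BASICALGORITHM(f)** (Hammer–Rosenberg–Rudeanu 1963, simplified by Hammer–Rudeanu 1968, as
presented by Boros–Hammer): eliminate `x_n` by the local-optimality choice `g_n`, recurse on
`f_{n−1}`, and “Set `x*_n = g_n(x*_1,…,x*_{n−1})`, and RETURN the binary vector `x* = (x*_1,…,x*_n)`.”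
(For `n = 0` the empty vector is returned; the printed base case `n = 1` is the first recursive step.)
[cite: BorosHammer2002, §4.6 BASICALGORITHM(f) (Input / Local optimality / Recursion / Output)]
[cite: HammerRudeanu1968, (the basic algorithm)] -/
def basicAlgorithm : (n : ℕ) → (Cube n → R) → Cube n
  | 0, _ => fun i => i.elim0
  | n + 1, f =>
      let y := basicAlgorithm n (elimLast f)
      snoc y (gLast f y)

omit [IsOrderedAddMonoid R] in
/-- The recursion unfolded one step. [cite: BorosHammer2002, §4.6 BASICALGORITHM (Recursion / Output)] -/
theorem basicAlgorithm_succ (f : Cube (n + 1) → R) :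
    basicAlgorithm (n + 1) f =
      snoc (basicAlgorithm n (elimLast f)) (gLast f (basicAlgorithm n (elimLast f))) := rfl

omit [IsOrderedAddMonoid R] in
/-- The value reached by the algorithm is the value of the eliminated problem at its own output:
`f(x*) = f_{n−1}(x*_1,…,x*_{n−1})`. [cite: BorosHammer2002, §4.6 BASICALGORITHM (Output: x*_n = g_n(x*_1,…,x*_{n−1}))] -/
theorem apply_basicAlgorithm_succ (f : Cube (n + 1) → R) :
    f (basicAlgorithm (n + 1) f) = elimLast f (basicAlgorithm n (elimLast f)) := rfl

/-- **Correctness of BASICALGORITHM: the returned vector is a global minimiser of `f`**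
(“`x*` … is returned as a minimizer of `f`”; the detailed proof is Hammer–Rudeanu's).
Proof: induction on `n` — `f(x*) = f_{n−1}(y*) ≤ f_{n−1}(x_1,…,x_{n−1}) ≤ f(x)`.
[cite: BorosHammer2002, §4.6 (BASICALGORITHM; Example 4.8 “x* = (1,0,1) is returned as a minimizer of f”; “for a detailed proof … the reader is referred to [91]”)] [cite: HammerRudeanu1968, (correctness of the basic algorithm)] -/
theorem apply_basicAlgorithm_le : ∀ (n : ℕ) (f : Cube n → R) (x : Cube n), f (basicAlgorithm n f) ≤ f x
  | 0, f, x => by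
      have : x = basicAlgorithm 0 f := funext fun i => i.elim0
      rw [this]
  | n + 1, f, x =>
      (apply_basicAlgorithm_succ f).le.trans
        ((apply_basicAlgorithm_le n (elimLast f) (init x)).trans (elimLast_init_le f x))

/-- The same, as membership in the argmin: `x*` minimises `f` on all of `Bⁿ`.
[cite: BorosHammer2002, §4.6 BASICALGORITHM (Output)] -/
theorem isMinOn_basicAlgorithm (n : ℕ) (f : Cube n → R) : IsMinOn f Set.univ (basicAlgorithm n f) :=
  fun x _ => apply_basicAlgorithm_le n f x

/-- The optimum VALUE: `f(x*) = min_{x ∈ Bⁿ} f(x)`. [cite: BorosHammer2002, §4.6 (“a general algorithm for finding the optimum of a pseudo-Boolean function”)] -/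
theorem apply_basicAlgorithm_eq_inf (n : ℕ) (f : Cube n → R) :
    f (basicAlgorithm n f) = univ.inf' univ_nonempty f := by
  refine le_antisymm ?_ (inf'_le _ (mem_univ _))
  exact (le_inf'_iff _ _).2 fun x _ => apply_basicAlgorithm_le n f x

/-- The eliminated problems have the same optimum value: `min f_{n−1} = min f`.
[cite: BorosHammer2002, §4.6 (“substitute the minimization problem with another one having one variable less”)] -/
theorem inf_elimLast_eq (f : Cube (n + 1) → R) :
    univ.inf' univ_nonempty (elimLast f) = univ.inf' univ_nonempty f := by
  rw [← apply_basicAlgorithm_eq_inf, ← apply_basicAlgorithm_eq_inf]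
  rfl

/-- **Maximisation** (“similar necessary conditions can be stated for maximization problems”): running
BASICALGORITHM on `−f` returns a global maximiser of `f`.
[cite: BorosHammer2002, §4.3 (“we shall state results only for the case of minimization problems, although similar necessary conditions can be stated for maximization problems”) and §2 (“we shall consider minimization and maximization problems”)] -/
theorem le_apply_basicAlgorithm_neg (n : ℕ) (f : Cube n → R) (x : Cube n) :
    f x ≤ f (basicAlgorithm n (fun z => -f z)) := by
  have h := apply_basicAlgorithm_le n (fun z => -f z) x
  exact neg_le_neg_iff.1 h

/-! ### Locality of one elimination step (the mechanism of Theorem 2, Crama–Hansen–Jaumard) -/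

/-- `f` depends only on the coordinates in `P`. [cite: BorosHammer2002, §4.6 proof of Theorem 2 (“Δ_n and thus g_n depend only on at most k of the variables”)] -/
def DependsOn {m : ℕ} (f : Cube m → R) (P : Finset (Fin m)) : Prop :=
  ∀ x x' : Cube m, (∀ i ∈ P, x i = x' i) → f x = f x'

omit [LinearOrder R] [IsOrderedAddMonoid R] in
/-- A term not involving `x_n` does not contribute to `Δ_n`: `Δ_n(u + v) = Δ_n(u)` when `v(y, b)` does
not depend on `b`. [cite: BorosHammer2002, §2 after eq. (4) (“the functions Δ_i and Θ_i … depend on all the variables, but x_i”) and §4.6 proof of Theorem 2] -/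
theorem deltaLast_add_of_indep (u v : Cube (n + 1) → R) (hv : ∀ y b, v (snoc y b) = v (snoc y false))
    (y : Cube n) : deltaLast (u + v) y = deltaLast u y := by
  unfold deltaLast
  rw [Pi.add_apply, Pi.add_apply, hv y true]
  abel

omit [IsOrderedAddMonoid R] in
/-- … hence the choice `g_n` is that of `u` alone, [cite: BorosHammer2002, §4.6 proof of Theorem 2 (“Δ_n and thus g_n depend only on at most k of the variables”)] -/
theorem gLast_add_of_indep (u v : Cube (n + 1) → R) (hv : ∀ y b, v (snoc y b) = v (snoc y false))
    (y : Cube n) : gLast (u + v) y = gLast u y := by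
  unfold gLast
  rw [deltaLast_add_of_indep u v hv]

omit [IsOrderedAddMonoid R] in
/-- … and the elimination step acts on `u` only: `(u + v)_{n−1} = u_{n−1} + v(·, 0)` — substituting
`g_n` into `f` creates new terms only among the variables of the terms containing `x_n`.
[cite: BorosHammer2002, §4.6 proof of Theorem 2 (“if the substitution of g_n into f = f_n … generates new terms … then for a new edge (i,j) … we must have {i,j} ⊆ P_n”)] -/
theorem elimLast_add_of_indep (u v : Cube (n + 1) → R) (hv : ∀ y b, v (snoc y b) = v (snoc y false))
    (y : Cube n) : elimLast (u + v) y = elimLast u y + v (snoc y false) := by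
  unfold elimLast
  rw [gLast_add_of_indep u v hv, Pi.add_apply, hv]

/-- If `u` depends only on the coordinates `P ⊆ {0,…,n}`, then `u_{n−1}` depends only on the
coordinates of `P` other than `n` (“the input to the next level is also a partial k-tree”).
[cite: BorosHammer2002, §4.6 proof of Theorem 2] [cite: CramaHansenJaumard1990, (Theorem 2 of Boros–Hammer: partial k-trees)] -/
theorem dependsOn_elimLast {u : Cube (n + 1) → R} {P : Finset (Fin (n + 1))} (hu : DependsOn u P) :
    DependsOn (elimLast u) (univ.filter fun i : Fin n => castSucc i ∈ P) := by
  intro y y' hyy'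
  have key : ∀ b, u (snoc y b) = u (snoc y' b) := by
    intro b
    refine hu _ _ fun i hi => ?_
    cases i using lastCases with
    | last => rw [snoc_last, snoc_last]
    | cast j =>
        rw [snoc_castSucc, snoc_castSucc]
        exact hyy' j (mem_filter.2 ⟨mem_univ _, hi⟩)
  rw [elimLast_eq_min, elimLast_eq_min, key false, key true]


/-! ### The multilinear polynomial, Proposition 3 for `Δ_n`, and the co-occurrence locality -/

section Multilinear

variable {m : ℕ}

/-- The value at `x ∈ Bᵐ` of the multilinear polynomial with coefficient family `c`:
`f(x) = Σ_{S ⊆ V} c_S Π_{j∈S} x_j` (the monomial is `1` iff `x_j = 1` for all `j ∈ S`).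
[cite: BorosHammer2002, §2 eq. (1) (“f(x_1,…,x_n) = Σ_{S⊆V} c_S Π_{j∈S} x_j”)] -/
def multilinearEval (c : Finset (Fin m) → R) (x : Cube m) : R :=
  ∑ S, if (∀ j ∈ S, x j = true) then c S else 0

/-- The co-occurrence neighbours of the last variable: the other variables `i` sharing a term
`S ∋ n` with `c_S ≠ 0` (“`(i,j) ∈ E` iff `f` has a term for which `S ⊇ {i,j}` and `c_S ≠ 0`”).
[cite: BorosHammer2002, §4.6 (definition of the co-occurrence graph G_f)] -/
def lastNeighbours (c : Finset (Fin (n + 1)) → R) : Finset (Fin n) :=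
  univ.filter fun i => ∃ S : Finset (Fin (n + 1)), c S ≠ 0 ∧ last n ∈ S ∧ castSucc i ∈ S

omit [LinearOrder R] [IsOrderedAddMonoid R] in
/-- A monomial not containing `x_n` takes the same value at `(y,0)` and `(y,1)`.
[cite: BorosHammer2002, §2 after eq. (4) (“Δ_i and Θ_i … depend on all the variables, but x_i”)] -/
private theorem monomial_snoc_of_not_mem {S : Finset (Fin (n + 1))} (hS : last n ∉ S) (y : Cube n)
    (b b' : Bool) : (∀ j ∈ S, (snoc y b : Cube (n + 1)) j = true) ↔ (∀ j ∈ S, (snoc y b' : Cube (n + 1)) j = true) := by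
  refine forall₂_congr fun j hj => ?_
  cases j using lastCases with
  | last => exact absurd hj hS
  | cast i => rw [snoc_castSucc, snoc_castSucc]

omit [LinearOrder R] [IsOrderedAddMonoid R] in
/-- **Proposition 3 for the last variable**: `Δ_n(x) = Σ_{S ∋ n} c_S Π_{j ∈ S∖{n}} x_j` — written at
the point `(y, ·)`, the monomial `Π_{j∈S∖{n}} x_j` being `[∀ j ∈ S, j ≠ n → y_j = 1]`.
[cite: BorosHammer2002, §4.1 Proposition 3 (“Δ_i(x) = Σ_{S∋i} c_S Π_{j∈S∖{i}} x_j”)] -/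
theorem deltaLast_multilinearEval (c : Finset (Fin (n + 1)) → R) (y : Cube n) :
    deltaLast (multilinearEval c) y =
      ∑ S ∈ univ.filter (fun S => last n ∈ S),
        if (∀ j ∈ S, j ≠ last n → (snoc y true : Cube (n + 1)) j = true) then c S else 0 := by
  unfold deltaLast multilinearEval
  rw [← sum_sub_distrib, ← sum_filter_add_sum_filter_not univ (fun S => last n ∈ S)]
  have hzero : ∑ S ∈ univ.filter (fun S => ¬ last n ∈ S),
      ((if (∀ j ∈ S, (snoc y true : Cube (n + 1)) j = true) then c S else 0) -
        (if (∀ j ∈ S, (snoc y false : Cube (n + 1)) j = true) then c S else 0)) = 0 := by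
    refine sum_eq_zero fun S hS => ?_
    have hn : last n ∉ S := (mem_filter.1 hS).2
    simp only [monomial_snoc_of_not_mem hn y true false, sub_self]
  rw [hzero, add_zero]
  refine sum_congr rfl fun S hS => ?_
  have hn : last n ∈ S := (mem_filter.1 hS).2
  have h0 : ¬ (∀ j ∈ S, (snoc y false : Cube (n + 1)) j = true) := fun h => by
    have := h _ hn
    rw [snoc_last] at this
    exact Bool.false_ne_true this
  rw [if_neg h0, sub_zero]
  have hiff : (∀ j ∈ S, (snoc y true : Cube (n + 1)) j = true) ↔
      (∀ j ∈ S, j ≠ last n → (snoc y true : Cube (n + 1)) j = true) := by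
    constructor
    · intro h j hj _; exact h j hj
    · intro h j hj
      by_cases hjn : j = last n
      · subst hjn; exact snoc_last _ _
      · exact h j hj hjn
  simp only [hiff]

omit [IsOrderedAddMonoid R] in
/-- **Locality of `Δ_n`**: the last derivative of a multilinear polynomial depends only on the
co-occurrence neighbours of `x_n` (the variables sharing a nonzero term with it) — “`Δ_n` and thus
`g_n` depend only on at most `k` of the variables” when those neighbours number `≤ k`.
[cite: BorosHammer2002, §4.6 proof of Theorem 2] [cite: CramaHansenJaumard1990, (the basic algorithm on bounded-width co-occurrence graphs)] -/
theorem dependsOn_deltaLast_multilinearEval (c : Finset (Fin (n + 1)) → R) :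
    DependsOn (deltaLast (multilinearEval c)) (lastNeighbours c) := by
  intro y y' hyy'
  rw [deltaLast_multilinearEval, deltaLast_multilinearEval]
  refine sum_congr rfl fun S hS => ?_
  have hn : last n ∈ S := (mem_filter.1 hS).2
  by_cases hc : c S = 0
  · simp [hc]
  · congr 1
    refine propext (forall₂_congr fun j hj => ?_)
    cases j using lastCases with
    | last => simp
    | cast i =>
        have hi : i ∈ lastNeighbours c := mem_filter.2 ⟨mem_univ _, S, hc, hn, hj⟩
        rw [snoc_castSucc, snoc_castSucc, hyy' i hi]

omit [IsOrderedAddMonoid R] in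
/-- Consequently the choice function `g_n` of BASICALGORITHM depends only on the co-occurrence
neighbours of `x_n`: its table has at most `2^{|N(n)|}` distinct arguments (the `2^k` of Theorem 2).
[cite: BorosHammer2002, §4.6 Theorem 2 (Crama et al.: “BASICALGORITHM can be implemented to run in polynomial time in the input size size(f) and in 2^k”) and its proof] -/
theorem gLast_eq_of_agree_on_lastNeighbours (c : Finset (Fin (n + 1)) → R) (y y' : Cube n)
    (h : ∀ i ∈ lastNeighbours c, y i = y' i) :
    gLast (multilinearEval c) y = gLast (multilinearEval c) y' := by
  unfold gLast
  rw [dependsOn_deltaLast_multilinearEval c y y' h]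

end Multilinear

end Literature.Combinatorics.Optimization.PseudoBooleanBasicAlgorithm
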